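import Summits.Parity.GeneralizedHardyLittlewood.Theorems.GreenTaoLevelTwoMNTwoSectionEightPiece

/-!
# Route `GreenTaoLevelTwo`, crux `MNTwo` (stmt-Parity-21276), line `birth`, stub `stub_mnVertical`:
# GT 2008b §8 — the reduction of "μ ⟂ local quadratics" to "μ ⟂ extendible local quadratics", core

Block V3 of the `stub_mnVertical` census (B. Green, T. Tao, *Quadratic uniformity of the Möbius
function*, Ann. Inst. Fourier 58 (2008) = arXiv:math/0606087, §8, proof that Proposition 19
implies Theorem 4), second file: the CORE ESTIMATE for a torus rotation `n ↦ F(x + nα)`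
(`F : ℝᵏ → ℝ` `1`-bounded, torus-`M`-Lipschitz) twisted by `e(−φ(n))`, `φ` locally quadratic on
`{N < n ≤ 2N : F(x+nα) ≠ 0}` (every `3`-cube inside the set has integral alternating sum), with
the torus partition of unity `(χ_a)_{a ∈ ι}` abstracted into hypotheses (`∑_a χ_a = 1`, `|χ_a| ≤ 1`,
torus-Lipschitz constant `K`, supports of torus-diameter `< ρ₀/4`) and the conclusion of
Proposition 19 at this `N` (hypothesis `hP`, printed form, see `…MNTwoSectionEightPiece`).
Proof as printed: soft-threshold `F` at level `100ρ₀M` (Lemma 41), cut `(N,2N]` into `≤ 8/ρ₀ + 1`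
bumps `θ_b(n) = R(n/ℓ − b + 1) − R(n/ℓ − b)` (`R` = clamp to `[0,1]`, `ℓ = ρ₀N/8`; the sum of the
bumps telescopes, the two ends of `(N, 2N]` of length `≈ 100ρ₀N` are estimated trivially), split
`F̃ = ∑_a F̃χ_a` and apply `piece_estimate` to each of the `(8/ρ₀+1)·#ι` pieces.  Def-free:

* `sectionEight_core` —
  `‖∑_{N<n≤2N} μ(n) F(x+nα) e(−φ(n))‖ ≤ 100ρ₀MN + 201ρ₀N + 1 + (8/ρ₀+1)·#ι·2(M+K+16/ρ₀)·C N/log^A N`.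

References: [GreenTao2008QuadraticMobius] arXiv:math/0606087 §8 (Prop. 19 ⇒ Thm. 4), App. A Lemma 41.
-/

noncomputable section

open Finset Real ArithmeticFunction
open scoped FourierTransform ArithmeticFunction.Moebius

namespace Summit.Parity.GeneralizedHardyLittlewood.GreenTaoLevelTwoMNTwoSectionEightCore

open Summit.Parity.GeneralizedHardyLittlewood.GreenTaoLevelTwoMNTwoSoftThreshold
open Summit.Parity.GeneralizedHardyLittlewood.GreenTaoLevelTwoMNTwoSectionEightPiece

/-! ### §3 The core estimate of §8 -/

/-- **GT 2008b §8, core of "Prop. 19 ⇒ Thm. 4" on a torus rotation.**  See the module docstring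
for the unpacking of the hypotheses; the partition of unity `χ` on the torus and the conclusion of
Proposition 19 (`hP`, at this `N`, rotation `α`, saving `A`, constant `C`) are hypotheses.
[cite: GreenTao2008QuadraticMobius, §8, proof that Proposition 19 implies Theorem 4] -/
theorem sectionEight_core (k : ℕ) {N : ℕ} (hN : 1 ≤ N) {M K ρ₀ C A : ℝ}
    (hM : 0 ≤ M) (hK : 0 ≤ K) (hρ₀ : 0 < ρ₀) (hρ₀' : 100000 * ρ₀ < 1) (hC : 0 ≤ C)
    (α x : Fin k → ℝ) (F : (Fin k → ℝ) → ℝ) (hF1 : ∀ y, |F y| ≤ 1)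
    (hFlip : ∀ (y y' : Fin k → ℝ) (t : ℝ), 0 ≤ t →
      (∀ i, ‖((y i - y' i : ℝ) : AddCircle (1 : ℝ))‖ ≤ t) → |F y - F y'| ≤ M * t)
    (φ : ℤ → ℝ)
    (hφ : ∀ n h₁ h₂ h₃ : ℤ,
      (∀ e₁ e₂ e₃ : ℕ, e₁ ≤ 1 → e₂ ≤ 1 → e₃ ≤ 1 →
        (N : ℤ) < n + e₁ * h₁ + e₂ * h₂ + e₃ * h₃ ∧ n + e₁ * h₁ + e₂ * h₂ + e₃ * h₃ ≤ 2 * N ∧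
          F (x + ((n + e₁ * h₁ + e₂ * h₂ + e₃ * h₃ : ℤ) : ℝ) • α) ≠ 0) →
      ∃ z : ℤ, φ (n + h₁ + h₂ + h₃) - φ (n + h₁ + h₂) - φ (n + h₁ + h₃) - φ (n + h₂ + h₃)
        + φ (n + h₁) + φ (n + h₂) + φ (n + h₃) - φ n = z)
    {ι : Type*} [Fintype ι] (χ : ι → (Fin k → ℝ) → ℝ)
    (hχsum : ∀ y, ∑ a, χ a y = 1) (hχ1 : ∀ a y, |χ a y| ≤ 1)
    (hχlip : ∀ a (y y' : Fin k → ℝ) (t : ℝ), 0 ≤ t →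
      (∀ i, ‖((y i - y' i : ℝ) : AddCircle (1 : ℝ))‖ ≤ t) → |χ a y - χ a y'| ≤ K * t)
    (hχsupp : ∀ a (y y' : Fin k → ℝ), χ a y ≠ 0 → χ a y' ≠ 0 →
      ∀ i, ‖((y i - y' i : ℝ) : AddCircle (1 : ℝ))‖ < ρ₀ / 4)
    (hP : ∀ (n₀ : ℤ) (ρ : ℝ), 0 < ρ → 100000 * ρ < 1 →
      (∀ n : ℤ, ((∀ i, ‖((((n - n₀ : ℤ) : ℝ) * α i : ℝ) : AddCircle (1 : ℝ))‖ +
          |((n - n₀ : ℤ) : ℝ)| / N < 100 * ρ) ∧ |((n - n₀ : ℤ) : ℝ)| / N < 100 * ρ) →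
        (N : ℤ) < n ∧ n ≤ 2 * N) →
      ∀ φ : ℤ → ℝ,
        (∀ n h₁ h₂ h₃ : ℤ,
          (∀ e₁ e₂ e₃ : ℕ, e₁ ≤ 1 → e₂ ≤ 1 → e₃ ≤ 1 →
            (∀ i, ‖((((n + e₁ * h₁ + e₂ * h₂ + e₃ * h₃ - n₀ : ℤ) : ℝ) * α i : ℝ) :
                AddCircle (1 : ℝ))‖ +
              |((n + e₁ * h₁ + e₂ * h₂ + e₃ * h₃ - n₀ : ℤ) : ℝ)| / N < 100 * ρ) ∧
            |((n + e₁ * h₁ + e₂ * h₂ + e₃ * h₃ - n₀ : ℤ) : ℝ)| / N < 100 * ρ) →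
          ∃ z : ℤ, φ (n + h₁ + h₂ + h₃) - φ (n + h₁ + h₂) - φ (n + h₁ + h₃) - φ (n + h₂ + h₃)
            + φ (n + h₁) + φ (n + h₂) + φ (n + h₃) - φ n = z) →
        ∀ ψ : ℤ → ℝ, (∀ n, 0 ≤ ψ n) →
          (∀ n, ψ n ≠ 0 →
            (∀ i, ‖((((n - n₀ : ℤ) : ℝ) * α i : ℝ) : AddCircle (1 : ℝ))‖ +
                |((n - n₀ : ℤ) : ℝ)| / N < ρ) ∧ |((n - n₀ : ℤ) : ℝ)| / N < ρ) →
          (∀ (n n' : ℤ) (t : ℝ), 0 ≤ t →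
            (∀ i, ‖((((n - n' : ℤ) : ℝ) * α i : ℝ) : AddCircle (1 : ℝ))‖ ≤ t) →
              |ψ n - ψ n'| ≤ t + |((n - n' : ℤ) : ℝ)| / N) →
          ‖∑ n ∈ Ioc N (2 * N), ((μ n : ℝ) : ℂ) * ((ψ n : ℝ) : ℂ) * (𝐞 (-(φ n)) : ℂ)‖ ≤
            C * N / Real.log N ^ A) :
    ‖∑ n ∈ Ioc N (2 * N), ((μ n : ℝ) : ℂ) * (F (x + (n : ℝ) • α) : ℂ) * (𝐞 (-(φ n)) : ℂ)‖ ≤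
      100 * ρ₀ * M * N + (201 * ρ₀ * N + 1) +
        (8 / ρ₀ + 1) * Fintype.card ι * (2 * (M + K + 16 / ρ₀) * (C * N / Real.log N ^ A)) := by
  classical
  -- basic quantities
  have hNr : (1 : ℝ) ≤ N := by exact_mod_cast hN
  have hNpos : (0 : ℝ) < N := by linarith
  have hρ₀1 : ρ₀ < 1 := by linarith
  set δ : ℝ := 100 * ρ₀ with hδ
  have hδpos : 0 < δ := by positivity
  set l : ℝ := δ * M with hl
  have hl0 : 0 ≤ l := by positivity
  set ℓ : ℝ := ρ₀ * N / 8 with hℓ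
  have hℓpos : 0 < ℓ := by positivity
  -- the thresholded function
  set Ft : (Fin k → ℝ) → ℝ := fun z => F z - max (-l) (min l (F z)) with hFt
  have hFt1 : ∀ z, |Ft z| ≤ 1 := fun z => softThreshold_bound hl0 hF1 z
  have hFtlip : ∀ (z z' : Fin k → ℝ) (t : ℝ), 0 ≤ t →
      (∀ i, ‖((z i - z' i : ℝ) : AddCircle (1 : ℝ))‖ ≤ t) → |Ft z - Ft z'| ≤ M * t :=
    fun z z' t ht hzz => (abs_softThreshold_sub_softThreshold_le hl0 _ _).trans (hFlip z z' t ht hzz)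
  have hFtclose : ∀ z, |F z - Ft z| ≤ l := fun z => softThreshold_close F hl0 z
  have hFsupp : ∀ z z' : Fin k → ℝ, Ft z ≠ 0 →
      (∀ i, ‖((z i - z' i : ℝ) : AddCircle (1 : ℝ))‖ ≤ 100 * ρ₀) → F z' ≠ 0 := by
    intro z z' hz hzz
    have hclose : |F z - F z'| ≤ l := by
      have := hFlip z z' (100 * ρ₀) (by positivity) hzz
      rw [hl, hδ]; linarith
    exact ne_zero_of_softThreshold_ne_zero hz hclose
  -- the bumps in `n`
  set θ : ℤ → ℤ → ℝ := fun b n =>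
    max 0 (min 1 ((n : ℝ) / ℓ - b + 1)) - max 0 (min 1 ((n : ℝ) / ℓ - b)) with hθ
  obtain ⟨hR01, hRmono, hR0, hR1⟩ := ramp_facts
  have hθ01 : ∀ b n, 0 ≤ θ b n ∧ θ b n ≤ 1 := fun b n => bump_nonneg_le_one b n
  have hθsupp : ∀ b n, θ b n ≠ 0 → ((b : ℝ) - 1) * ℓ < n ∧ (n : ℝ) < (b + 1) * ℓ :=
    fun b n h => bump_support hℓpos b n h
  have hθlip : ∀ b n n', |θ b n - θ b n'| ≤ 16 / ρ₀ * (|((n - n' : ℤ) : ℝ)| / N) := by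
    intro b n n'
    have h := abs_bump_sub_bump_le hℓpos b n n'
    have hℓρ : 2 * |((n - n' : ℤ) : ℝ)| / ℓ = 16 / ρ₀ * (|((n - n' : ℤ) : ℝ)| / N) := by
      rw [hℓ]; field_simp; ring
    simp only [hθ]
    rw [← hℓρ]; exact h
  -- the range of bumps
  set B₀ : ℤ := ⌈8 * (1 + δ) / ρ₀⌉ + 1 with hB₀
  set B₁ : ℤ := ⌊8 * (2 - δ) / ρ₀⌋ - 1 with hB₁
  set Kb : ℕ := (B₁ - B₀ + 1).toNat with hKb
  have hℓρ : ∀ c : ℝ, ℓ * (8 * c / ρ₀) = c * N := fun c => by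
    rw [hℓ]; field_simp
  have hB₀lo : (N : ℝ) + δ * N ≤ ℓ * ((B₀ : ℝ) - 1) := by
    have h1 : (8 * (1 + δ) / ρ₀ : ℝ) ≤ ⌈8 * (1 + δ) / ρ₀⌉ := Int.le_ceil _
    have h2 : ((B₀ : ℤ) : ℝ) - 1 = ⌈8 * (1 + δ) / ρ₀⌉ := by rw [hB₀]; push_cast; ring
    rw [h2]
    calc (N : ℝ) + δ * N = ℓ * (8 * (1 + δ) / ρ₀) := by rw [hℓρ]; ring
      _ ≤ _ := mul_le_mul_of_nonneg_left h1 hℓpos.le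
  have hB₀hi : ℓ * (B₀ : ℝ) ≤ (N : ℝ) + δ * N + 2 * ℓ := by
    have h1 : (⌈8 * (1 + δ) / ρ₀⌉ : ℝ) < 8 * (1 + δ) / ρ₀ + 1 := Int.ceil_lt_add_one _
    have h2 : ((B₀ : ℤ) : ℝ) = ⌈8 * (1 + δ) / ρ₀⌉ + 1 := by rw [hB₀]; push_cast; ring
    rw [h2]
    calc ℓ * ((⌈8 * (1 + δ) / ρ₀⌉ : ℝ) + 1) ≤ ℓ * (8 * (1 + δ) / ρ₀ + 1 + 1) :=
          mul_le_mul_of_nonneg_left (by linarith) hℓpos.le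
      _ = (N : ℝ) + δ * N + 2 * ℓ := by rw [mul_add, mul_add, hℓρ]; ring
  have hB₁hi : ℓ * ((B₁ : ℝ) + 1) ≤ 2 * (N : ℝ) - δ * N := by
    have h1 : (⌊8 * (2 - δ) / ρ₀⌋ : ℝ) ≤ 8 * (2 - δ) / ρ₀ := Int.floor_le _
    have h2 : ((B₁ : ℤ) : ℝ) + 1 = ⌊8 * (2 - δ) / ρ₀⌋ := by rw [hB₁]; push_cast; ring
    rw [h2]
    calc ℓ * (⌊8 * (2 - δ) / ρ₀⌋ : ℝ) ≤ ℓ * (8 * (2 - δ) / ρ₀) :=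
          mul_le_mul_of_nonneg_left h1 hℓpos.le
      _ = 2 * (N : ℝ) - δ * N := by rw [hℓρ]; ring
  have hB₁lo : 2 * (N : ℝ) - δ * N - 2 * ℓ ≤ ℓ * (B₁ : ℝ) := by
    have h1 : (8 * (2 - δ) / ρ₀ : ℝ) < ⌊8 * (2 - δ) / ρ₀⌋ + 1 := Int.lt_floor_add_one _
    have h2 : ((B₁ : ℤ) : ℝ) = ⌊8 * (2 - δ) / ρ₀⌋ - 1 := by rw [hB₁]; push_cast; ring
    rw [h2]
    calc 2 * (N : ℝ) - δ * N - 2 * ℓ = ℓ * (8 * (2 - δ) / ρ₀ - 1 - 1) := by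
          rw [mul_sub, mul_sub, hℓρ]; ring
      _ ≤ ℓ * ((⌊8 * (2 - δ) / ρ₀⌋ : ℝ) - 1) :=
          mul_le_mul_of_nonneg_left (by linarith) hℓpos.le
  have hKble : (Kb : ℝ) ≤ 8 / ρ₀ + 1 := by
    rcases le_or_gt (B₁ - B₀ + 1) 0 with h | h
    · have : Kb = 0 := by rw [hKb]; exact Int.toNat_of_nonpos h
      rw [this]; simp only [CharP.cast_eq_zero]; positivity
    · have hK : ((Kb : ℕ) : ℤ) = B₁ - B₀ + 1 := by rw [hKb]; exact Int.toNat_of_nonneg h.le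
      have hKr : (Kb : ℝ) = (B₁ : ℝ) - B₀ + 1 := by exact_mod_cast hK
      have h1 : ℓ * (Kb : ℝ) ≤ ℓ * (8 / ρ₀ + 1) := by
        rw [hKr]
        have : ℓ * ((B₁ : ℝ) - B₀ + 1) = ℓ * ((B₁ : ℝ) + 1) - ℓ * ((B₀ : ℝ) - 1) - ℓ := by ring
        rw [this]
        have h8 : ℓ * (8 / ρ₀ + 1) = N + ℓ := by
          rw [mul_add, show (8 / ρ₀ : ℝ) = 8 * 1 / ρ₀ by ring, hℓρ]; ring
        rw [h8]
        have hδN : 0 ≤ δ * N := by positivity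
        linarith
      exact le_of_mul_le_mul_left h1 hℓpos
  have hKbge : B₁ - B₀ + 1 ≤ (Kb : ℤ) := by rw [hKb]; exact Int.self_le_toNat _
  -- the partition in `n`: `Pn n = ∑_{i < Kb} θ (B₀ + i) n`, telescoped
  set Pn : ℤ → ℝ := fun n => ∑ i ∈ range Kb, θ (B₀ + i) n with hPn
  have hPn_eq : ∀ n : ℤ, Pn n = max 0 (min 1 ((n : ℝ) / ℓ - B₀ + 1)) -
      max 0 (min 1 ((n : ℝ) / ℓ - B₀ + 1 - Kb)) := by
    intro n
    simp only [hPn, hθ]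
    have h := sum_range_sub' (fun i : ℕ => max 0 (min 1 ((n : ℝ) / ℓ - B₀ + 1 - i))) Kb
    simp only [Nat.cast_zero, sub_zero] at h
    rw [← h]
    refine sum_congr rfl fun i _ => ?_
    push_cast
    ring_nf
  have hPn01 : ∀ n, 0 ≤ Pn n ∧ Pn n ≤ 1 := by
    intro n
    rw [hPn_eq]
    have h1 := hRmono ((n : ℝ) / ℓ - B₀ + 1 - Kb) ((n : ℝ) / ℓ - B₀ + 1)
      (by linarith [Nat.cast_nonneg (α := ℝ) Kb])
    have h2 := hR01 ((n : ℝ) / ℓ - B₀ + 1)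
    have h3 := hR01 ((n : ℝ) / ℓ - B₀ + 1 - Kb)
    exact ⟨by linarith, by linarith⟩
  have hPn_one : ∀ n : ℤ, ℓ * B₀ ≤ n → (n : ℝ) ≤ ℓ * B₁ → Pn n = 1 := by
    intro n h1 h2
    rw [hPn_eq]
    have hu1 : 1 ≤ (n : ℝ) / ℓ - B₀ + 1 := by
      have : (B₀ : ℝ) ≤ n / ℓ := by rw [le_div_iff₀ hℓpos]; linarith
      linarith
    have hKr : (B₁ : ℝ) - B₀ + 1 ≤ Kb := by exact_mod_cast hKbge
    have hu2 : (n : ℝ) / ℓ - B₀ + 1 - Kb ≤ 0 := by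
      have : (n : ℝ) / ℓ ≤ B₁ := by rw [div_le_iff₀ hℓpos]; linarith
      linarith
    rw [hR1 _ hu1, hR0 _ hu2, sub_zero]
  -- orbit points
  set y : ℤ → (Fin k → ℝ) := fun n => x + (n : ℝ) • α with hy
  have hyn : ∀ n : ℕ, x + (n : ℝ) • α = y n := fun n => by simp [hy]
  have hlogA : 0 ≤ C * N / Real.log N ^ A :=
    div_nonneg (by positivity) (Real.rpow_nonneg (Real.log_nonneg hNr) A)
  -- ### the per-piece estimate
  have hpiece : ∀ (a : ι) (i : ℕ), i < Kb →
      ‖∑ n ∈ Ioc N (2 * N), ((μ n : ℝ) : ℂ) *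
          ((Ft (x + (n : ℝ) • α) * χ a (x + (n : ℝ) • α) * θ (B₀ + i) n : ℝ) : ℂ) *
            (𝐞 (-(φ n)) : ℂ)‖ ≤
        2 * (M + K + 16 / ρ₀) * (C * N / Real.log N ^ A) := by
    intro a i hi
    set b : ℤ := B₀ + i with hb
    have hbB₀ : (B₀ : ℝ) ≤ b := by rw [hb]; push_cast; linarith [Nat.cast_nonneg (α := ℝ) i]
    have hbB₁ : (b : ℝ) ≤ B₁ := by
      have hK : (Kb : ℤ) = B₁ - B₀ + 1 := by
        rw [hKb]; exact Int.toNat_of_nonneg (by omega)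
      have : b ≤ B₁ := by rw [hb]; omega
      exact_mod_cast this
    have hblo : (N : ℝ) + δ * N ≤ ((b : ℝ) - 1) * ℓ := by
      have := mul_le_mul_of_nonneg_left (sub_le_sub_right hbB₀ 1) hℓpos.le
      linarith
    have hbhi : ((b : ℝ) + 1) * ℓ ≤ 2 * N - δ * N := by
      have := mul_le_mul_of_nonneg_left (add_le_add_right hbB₁ 1) hℓpos.le
      linarith
    refine piece_estimate k hN hM hK hρ₀ hρ₀' hC α x F Ft (χ a) (θ b) hFt1 hFtlip hFsupp
      (hχ1 a) (hχlip a) (hχsupp a) (hθ01 b) (hθlip b) ?_ ?_ φ hφ hP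
    · -- support of the bump has diameter `< 2ℓ = ρ₀ N / 4`
      intro n n' hn hn'
      obtain ⟨h1, h2⟩ := hθsupp b n hn
      obtain ⟨h3, h4⟩ := hθsupp b n' hn'
      have h2ℓ : 2 * ℓ = ρ₀ / 4 * N := by rw [hℓ]; ring
      rw [← h2ℓ, abs_lt]
      push_cast
      constructor <;> linarith
    · -- the `100ρ₀N`-neighbourhood of the bump lies in `(N, 2N]`
      intro n n' hn hd
      obtain ⟨h1, h2⟩ := hθsupp b n hn
      rw [abs_lt] at hd
      push_cast at hd
      rw [hδ] at hblo hbhi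
      have h3 : (N : ℝ) < n' := by linarith
      have h4 : (n' : ℝ) < 2 * N := by linarith
      exact ⟨by exact_mod_cast h3, by exact_mod_cast h4.le⟩
  -- ### the three-way split of the sum
  have hsplit : ∀ n : ℕ, ((μ n : ℝ) : ℂ) * (F (x + (n : ℝ) • α) : ℂ) * (𝐞 (-(φ n)) : ℂ) =
      ((μ n : ℝ) : ℂ) * ((F (y n) - Ft (y n) : ℝ) : ℂ) * (𝐞 (-(φ n)) : ℂ) +
      ((μ n : ℝ) : ℂ) * ((Ft (y n) * (1 - Pn n) : ℝ) : ℂ) * (𝐞 (-(φ n)) : ℂ) +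
      ∑ i ∈ range Kb, ∑ a, ((μ n : ℝ) : ℂ) *
        ((Ft (x + (n : ℝ) • α) * χ a (x + (n : ℝ) • α) * θ (B₀ + i) n : ℝ) : ℂ) *
          (𝐞 (-(φ n)) : ℂ) := by
    intro n
    have hχC : ∑ a, ((χ a (y n) : ℝ) : ℂ) = 1 := by
      rw [← Complex.ofReal_sum, hχsum (y n), Complex.ofReal_one]
    have h3 : ∑ i ∈ range Kb, ∑ a, ((μ n : ℝ) : ℂ) *
        ((Ft (x + (n : ℝ) • α) * χ a (x + (n : ℝ) • α) * θ (B₀ + i) n : ℝ) : ℂ) *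
          (𝐞 (-(φ n)) : ℂ) =
        ((μ n : ℝ) : ℂ) * ((Ft (y n) * Pn n : ℝ) : ℂ) * (𝐞 (-(φ n)) : ℂ) := by
      simp_rw [hyn n]
      calc ∑ i ∈ range Kb, ∑ a, ((μ n : ℝ) : ℂ) *
            ((Ft (y n) * χ a (y n) * θ (B₀ + i) n : ℝ) : ℂ) * (𝐞 (-(φ n)) : ℂ)
          = ∑ i ∈ range Kb, (((μ n : ℝ) : ℂ) * ((Ft (y n) * θ (B₀ + i) n : ℝ) : ℂ) *
              (𝐞 (-(φ n)) : ℂ)) * ∑ a, ((χ a (y n) : ℝ) : ℂ) := by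
            refine sum_congr rfl fun i _ => ?_
            rw [mul_sum]
            refine sum_congr rfl fun a _ => ?_
            push_cast; ring
        _ = ∑ i ∈ range Kb, ((μ n : ℝ) : ℂ) * ((Ft (y n) * θ (B₀ + i) n : ℝ) : ℂ) *
              (𝐞 (-(φ n)) : ℂ) := by simp_rw [hχC, mul_one]
        _ = ((μ n : ℝ) : ℂ) * ((Ft (y n) : ℂ) * ∑ i ∈ range Kb, ((θ (B₀ + i) n : ℝ) : ℂ)) *
              (𝐞 (-(φ n)) : ℂ) := by
            rw [mul_sum, mul_sum, sum_mul]
            refine sum_congr rfl fun i _ => ?_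
            push_cast; ring
        _ = ((μ n : ℝ) : ℂ) * ((Ft (y n) * Pn n : ℝ) : ℂ) * (𝐞 (-(φ n)) : ℂ) := by
            simp only [hPn]; push_cast; ring
    rw [h3, hyn]
    push_cast; ring
  rw [sum_congr rfl fun n _ => hsplit n, sum_add_distrib, sum_add_distrib]
  -- T1: the thresholding error
  have hT1 : ‖∑ n ∈ Ioc N (2 * N), ((μ n : ℝ) : ℂ) * ((F (y n) - Ft (y n) : ℝ) : ℂ) *
      (𝐞 (-(φ n)) : ℂ)‖ ≤ 100 * ρ₀ * M * N := by
    calc ‖∑ n ∈ Ioc N (2 * N), ((μ n : ℝ) : ℂ) * ((F (y n) - Ft (y n) : ℝ) : ℂ) *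
          (𝐞 (-(φ n)) : ℂ)‖
        ≤ ∑ n ∈ Ioc N (2 * N), ‖((μ n : ℝ) : ℂ) * ((F (y n) - Ft (y n) : ℝ) : ℂ) *
            (𝐞 (-(φ n)) : ℂ)‖ := norm_sum_le _ _
      _ ≤ ∑ n ∈ Ioc N (2 * N), l := sum_le_sum fun n _ =>
          (norm_moebius_mul_mul_fourierChar_le _ _ _).trans (hFtclose _)
      _ = N * l := by
          rw [sum_const, Nat.card_Ioc, nsmul_eq_mul]
          congr 1
          rw [show 2 * N - N = N by omega]
      _ = 100 * ρ₀ * M * N := by rw [hl, hδ]; ring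
  -- T2: the two ends of `(N, 2N]`
  have hT2 : ‖∑ n ∈ Ioc N (2 * N), ((μ n : ℝ) : ℂ) * ((Ft (y n) * (1 - Pn n) : ℝ) : ℂ) *
      (𝐞 (-(φ n)) : ℂ)‖ ≤ 201 * ρ₀ * N + 1 := by
    have hδN : 0 ≤ δ * N := by positivity
    have hX : (N : ℝ) ≤ ℓ * B₀ := by
      have : ℓ * ((B₀ : ℝ) - 1) = ℓ * B₀ - ℓ := by ring
      linarith
    have hY0 : 0 ≤ ℓ * B₁ := by
      have : δ * N + 2 * ℓ ≤ 2 * N := by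
        rw [hδ, hℓ]; nlinarith
      linarith
    have hY : ℓ * B₁ ≤ 2 * N := by
      have : ℓ * ((B₁ : ℝ) + 1) = ℓ * B₁ + ℓ := by ring
      linarith
    have hcount1 := card_filter_lt_le (N := N) hX
    have hcount2 := card_filter_gt_le (N := N) hY0 hY
    calc ‖∑ n ∈ Ioc N (2 * N), ((μ n : ℝ) : ℂ) * ((Ft (y n) * (1 - Pn n) : ℝ) : ℂ) *
          (𝐞 (-(φ n)) : ℂ)‖
        ≤ ∑ n ∈ Ioc N (2 * N), ‖((μ n : ℝ) : ℂ) * ((Ft (y n) * (1 - Pn n) : ℝ) : ℂ) *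
            (𝐞 (-(φ n)) : ℂ)‖ := norm_sum_le _ _
      _ ≤ ∑ n ∈ Ioc N (2 * N), ((if (n : ℝ) < ℓ * B₀ then (1 : ℝ) else 0) +
            (if ℓ * B₁ < (n : ℝ) then (1 : ℝ) else 0)) := by
          refine sum_le_sum fun n _ => (norm_moebius_mul_mul_fourierChar_le _ _ _).trans ?_
          have h1 : |Ft (y n) * (1 - Pn n)| ≤ |1 - Pn n| := by
            rw [abs_mul]
            calc |Ft (y n)| * |1 - Pn n| ≤ 1 * |1 - Pn n| :=
                  mul_le_mul_of_nonneg_right (hFt1 _) (abs_nonneg _)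
              _ = |1 - Pn n| := one_mul _
          refine h1.trans ?_
          have hP1 : |1 - Pn n| ≤ 1 := by
            have := hPn01 n
            rw [abs_le]; constructor <;> linarith [this.1, this.2]
          by_cases hlo : (n : ℝ) < ℓ * B₀
          · rw [if_pos hlo]
            have h3 : (0 : ℝ) ≤ if ℓ * B₁ < (n : ℝ) then (1 : ℝ) else 0 := by
              split_ifs <;> norm_num
            linarith
          · by_cases hhi : ℓ * B₁ < (n : ℝ)
            · rw [if_neg hlo, if_pos hhi]; linarith
            · rw [if_neg hlo, if_neg hhi]
              push Not at hlo hhi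
              have : Pn n = 1 := hPn_one n (by exact_mod_cast hlo) (by exact_mod_cast hhi)
              rw [this]; simp
      _ = (#((Ioc N (2 * N)).filter fun n : ℕ => (n : ℝ) < ℓ * B₀) : ℝ) +
            (#((Ioc N (2 * N)).filter fun n : ℕ => ℓ * B₁ < (n : ℝ)) : ℝ) := by
          rw [sum_add_distrib, sum_boole, sum_boole]
      _ ≤ (ℓ * B₀ - N) + (2 * N - ℓ * B₁ + 1) := add_le_add hcount1 hcount2
      _ ≤ 2 * (δ * N) + 4 * ℓ + 1 := by linarith
      _ ≤ 201 * ρ₀ * N + 1 := by rw [hδ, hℓ]; nlinarith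
  -- T3: the pieces
  have hT3 : ‖∑ n ∈ Ioc N (2 * N), ∑ i ∈ range Kb, ∑ a, ((μ n : ℝ) : ℂ) *
      ((Ft (x + (n : ℝ) • α) * χ a (x + (n : ℝ) • α) * θ (B₀ + i) n : ℝ) : ℂ) *
        (𝐞 (-(φ n)) : ℂ)‖ ≤
      (8 / ρ₀ + 1) * Fintype.card ι * (2 * (M + K + 16 / ρ₀) * (C * N / Real.log N ^ A)) := by
    rw [sum_comm]
    have hswap : ∀ i ∈ range Kb, ∑ n ∈ Ioc N (2 * N), ∑ a, ((μ n : ℝ) : ℂ) *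
        ((Ft (x + (n : ℝ) • α) * χ a (x + (n : ℝ) • α) * θ (B₀ + i) n : ℝ) : ℂ) *
          (𝐞 (-(φ n)) : ℂ) =
        ∑ a, ∑ n ∈ Ioc N (2 * N), ((μ n : ℝ) : ℂ) *
          ((Ft (x + (n : ℝ) • α) * χ a (x + (n : ℝ) • α) * θ (B₀ + i) n : ℝ) : ℂ) *
            (𝐞 (-(φ n)) : ℂ) :=
      fun i _ => sum_comm
    rw [sum_congr rfl hswap]
    calc ‖∑ i ∈ range Kb, ∑ a, ∑ n ∈ Ioc N (2 * N), ((μ n : ℝ) : ℂ) *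
          ((Ft (x + (n : ℝ) • α) * χ a (x + (n : ℝ) • α) * θ (B₀ + i) n : ℝ) : ℂ) *
            (𝐞 (-(φ n)) : ℂ)‖
        ≤ ∑ i ∈ range Kb, ‖∑ a, ∑ n ∈ Ioc N (2 * N), ((μ n : ℝ) : ℂ) *
          ((Ft (x + (n : ℝ) • α) * χ a (x + (n : ℝ) • α) * θ (B₀ + i) n : ℝ) : ℂ) *
            (𝐞 (-(φ n)) : ℂ)‖ := norm_sum_le _ _
      _ ≤ ∑ i ∈ range Kb, ∑ a, ‖∑ n ∈ Ioc N (2 * N), ((μ n : ℝ) : ℂ) *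
          ((Ft (x + (n : ℝ) • α) * χ a (x + (n : ℝ) • α) * θ (B₀ + i) n : ℝ) : ℂ) *
            (𝐞 (-(φ n)) : ℂ)‖ :=
          sum_le_sum fun i _ => norm_sum_le _ _
      _ ≤ ∑ i ∈ range Kb, ∑ a : ι, 2 * (M + K + 16 / ρ₀) * (C * N / Real.log N ^ A) :=
          sum_le_sum fun i hi => sum_le_sum fun a _ => hpiece a i (mem_range.1 hi)
      _ = Kb * (Fintype.card ι * (2 * (M + K + 16 / ρ₀) * (C * N / Real.log N ^ A))) := by
          rw [sum_const, card_range, nsmul_eq_mul, sum_const, card_univ, nsmul_eq_mul]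
      _ ≤ (8 / ρ₀ + 1) * (Fintype.card ι * (2 * (M + K + 16 / ρ₀) * (C * N / Real.log N ^ A))) :=
          mul_le_mul_of_nonneg_right hKble (by positivity)
      _ = (8 / ρ₀ + 1) * Fintype.card ι * (2 * (M + K + 16 / ρ₀) * (C * N / Real.log N ^ A)) := by
          ring
  calc ‖∑ n ∈ Ioc N (2 * N), ((μ n : ℝ) : ℂ) * ((F (y n) - Ft (y n) : ℝ) : ℂ) * (𝐞 (-(φ n)) : ℂ) +
        ∑ n ∈ Ioc N (2 * N), ((μ n : ℝ) : ℂ) * ((Ft (y n) * (1 - Pn n) : ℝ) : ℂ) *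
          (𝐞 (-(φ n)) : ℂ) +
        ∑ n ∈ Ioc N (2 * N), ∑ i ∈ range Kb, ∑ a, ((μ n : ℝ) : ℂ) *
          ((Ft (x + (n : ℝ) • α) * χ a (x + (n : ℝ) • α) * θ (B₀ + i) n : ℝ) : ℂ) *
            (𝐞 (-(φ n)) : ℂ)‖
      ≤ _ := norm_add₃_le
    _ ≤ 100 * ρ₀ * M * N + (201 * ρ₀ * N + 1) +
        (8 / ρ₀ + 1) * Fintype.card ι * (2 * (M + K + 16 / ρ₀) * (C * N / Real.log N ^ A)) :=
        add_le_add (add_le_add hT1 hT2) hT3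

end Summit.Parity.GeneralizedHardyLittlewood.GreenTaoLevelTwoMNTwoSectionEightCore
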